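import Summits.Ventures.PercRepro.ThetaOmegaSplit

/-!
# A point whose only edge joins two members of the same anti colours is good

Dossier proofs/MINE1-theoremS.md, Addendum 80 suppl. 1 (i) (mine-1, gen 41). Let `q` be a point of
the ground set and `s, s + q` two members of `F` with the SAME colours `(α, β)`, `α ≠ β` (both
anti, in the language of the addendum). Although the edge family `{s}` (coloured `(α, β)`) is
exceptional — its (Ω)-count is `0` — any third member `w` of `F` produces a `q`-edge of the
`A`-family or of the `C`-family of `F`: with `q ∈ w` the meet `s ⊓ w` (when `c0 w = α`) or the
difference `w \ (s + q)` (when `c0 w = β`); with `q ∉ w` the co-join `U \ ((s + q) ⊔ w)` (when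
`c1 w = β`) or the difference `s \ w` (when `c1 w = α`). So the credit at `q` is at least one
(`one_le_credit_of_anti_same`), which is all the induction step needs when `{s}` is the whole
edge family (`card_le_omegaCount_of_step'`, `card_le_omegaCount_of_anti_same`). In the all-anti
colouring of a (Σ)-instance this is the point with a single consistent pair and a third member
(Addendum 79: `one_le_card_creditS_of_partner`), now in the twice-coloured language.
-/

namespace PercRepro.MSTight

open Finset

variable {α : Type*} [DecidableEq α]

section AntiSame

variable {q : α} {U : Finset α} {F : Finset (Finset α)} {c0 c1 : Finset α → Bool}

/-- Putting `q` into the meet of `s` with `w ∋ q` gives the meet of `s + q` with `w`. -/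
theorem insert_inf_of_mem {s w : Finset α} (hw : q ∈ w) :
    insert q (s ⊓ w) = insert q s ⊓ w := by
  ext a
  simp only [mem_insert, inf_eq_inter, mem_inter]
  constructor
  · rintro (rfl | ⟨ha, ha'⟩)
    · exact ⟨Or.inl rfl, hw⟩
    · exact ⟨Or.inr ha, ha'⟩
  · rintro ⟨rfl | ha, ha'⟩
    · exact Or.inl rfl
    · exact Or.inr ⟨ha, ha'⟩

/-- Putting `q` into `w \ (s + q)` gives `w \ s` when `q ∈ w` and `q ∉ s`. -/
theorem insert_sdiff_insert_of_mem {s w : Finset α} (hw : q ∈ w) (hs : q ∉ s) :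
    insert q (w \ insert q s) = w \ s := by
  ext a
  simp only [mem_insert, mem_sdiff, not_or]
  constructor
  · rintro (rfl | ⟨ha, -, ha'⟩)
    · exact ⟨hw, hs⟩
    · exact ⟨ha, ha'⟩
  · rintro ⟨ha, ha'⟩
    by_cases haq : a = q
    · exact Or.inl haq
    · exact Or.inr ⟨ha, haq, ha'⟩

/-- **The third-member credit**: if `s` and `s + q` are members with the same colours `(α, β)`,
`α ≠ β`, then every further member `w ⊆ U` gives a `q`-edge of the `A`- or the `C`-family. -/
theorem one_le_credit_of_anti_same (hq : q ∈ U) {s w : Finset α} (hs : s ∈ F) (hqs : q ∉ s)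
    (hsq : insert q s ∈ F) (h0 : c0 (insert q s) = c0 s) (h1 : c1 (insert q s) = c1 s)
    (hanti : c0 s ≠ c1 s) (hw : w ∈ F) (hws : w ≠ s) (hwsq : w ≠ insert q s) :
    1 ≤ (qEdges q (omegaA F c0 c1)).card + (qEdges q (omegaC U F c1)).card := by
  have hsq_ne : s ≠ insert q s := fun h => hqs (h ▸ mem_insert_self q s)
  by_cases hqw : q ∈ w
  · -- `w` contains `q`
    by_cases hcw : c0 w = c0 s
    · -- the meet edge `(s ⊓ w, (s + q) ⊓ w)`
      have hd : s ⊓ w ∈ qEdges q (omegaA F c0 c1) := by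
        rw [mem_qEdges]
        refine ⟨inf_mem_omegaA (Ne.symm hws) hs hw hcw.symm, ?_, ?_⟩
        · simp only [inf_eq_inter, mem_inter, not_and]
          exact fun h => absurd h hqs
        · rw [insert_inf_of_mem hqw]
          exact inf_mem_omegaA (Ne.symm hwsq) hsq hw (h0.trans hcw.symm)
      have := card_pos.2 ⟨_, hd⟩
      omega
    · -- `c0 w = c1 s`: the difference edge `(w \ (s + q), w \ s)`
      have hcw' : c0 w = c1 s := bool_eq_of_ne_of_ne hcw (Ne.symm hanti)
      have hd : w \ insert q s ∈ qEdges q (omegaA F c0 c1) := by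
        rw [mem_qEdges]
        refine ⟨sdiff_mem_omegaA hw hsq (hcw'.trans h1.symm), ?_, ?_⟩
        · simp only [mem_sdiff, mem_insert, true_or, not_true_eq_false, and_false,
            not_false_eq_true]
        · rw [insert_sdiff_insert_of_mem hqw hqs]
          exact sdiff_mem_omegaA hw hs hcw'
      have := card_pos.2 ⟨_, hd⟩
      omega
  · -- `w` avoids `q`
    by_cases hcw : c1 w = c1 s
    · -- the co-join edge `(U \ ((s + q) ⊔ w), U \ (s ⊔ w))`
      have hd : U \ (insert q s ⊔ w) ∈ qEdges q (omegaC U F c1) := by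
        rw [mem_qEdges]
        refine ⟨sdiff_sup_mem_omegaC (Ne.symm hwsq) hsq hw (h1.trans hcw.symm), ?_, ?_⟩
        · simp only [mem_sdiff, sup_eq_union, mem_union, mem_insert, true_or, not_true_eq_false,
            and_false, not_false_eq_true]
        · rw [sdiff_insert_sup_eq, insert_sdiff_erase_sup hq hqs hqw]
          exact sdiff_sup_mem_omegaC (Ne.symm hws) hs hw hcw.symm
      have := card_pos.2 ⟨_, hd⟩
      omega
    · -- `c1 w = c0 s`: the difference edge `(s \ w, (s + q) \ w)`
      have hcw' : c1 w = c0 s := bool_eq_of_ne_of_ne hcw hanti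
      have hd : s \ w ∈ qEdges q (omegaA F c0 c1) := by
        rw [mem_qEdges]
        refine ⟨sdiff_mem_omegaA hs hw hcw'.symm, ?_, ?_⟩
        · simp only [mem_sdiff, not_and]
          exact fun h => absurd h hqs
        · rw [← insert_sdiff_of_notMem' hqw]
          exact sdiff_mem_omegaA hsq hw (h0.trans hcw'.symm)
      have := card_pos.2 ⟨_, hd⟩
      omega

/-- **The induction step with the credit given directly**: if the oriented projection satisfies
its bound and the credit at `q` is at least the number of edges, so does `F`. -/
theorem card_le_omegaCount_of_step' {o : Finset α → Bool} (ho : ValidOrient q F o)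
    (hP : (projFam q F).card ≤
      omegaCount (U.erase q) (projFam q F) (projColour q o c0) (projColour q o c1))
    (hcred : (qEdges q F).card ≤
      (qEdges q (omegaA F c0 c1)).card + (qEdges q (omegaC U F c1)).card) :
    F.card ≤ omegaCount U F c0 c1 := by
  have hsplit : F.card = (projFam q F).card + (qEdges q F).card :=
    card_eq_card_image_erase_add_card_qEdges q F
  have hlift := omegaCount_proj_add_le (U := U) (c0 := c0) (c1 := c1) ho
  omega

/-- **A point whose only edge joins two members of the same anti colours is good**: with a third
member, the bound for `F` follows from the bound for the oriented projection. -/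
theorem card_le_omegaCount_of_anti_same {o : Finset α → Bool} (hq : q ∈ U) (ho : ValidOrient q F o)
    {s w : Finset α} (hs : s ∈ F) (hqs : q ∉ s) (hsq : insert q s ∈ F)
    (h0 : c0 (insert q s) = c0 s) (h1 : c1 (insert q s) = c1 s) (hanti : c0 s ≠ c1 s)
    (hw : w ∈ F) (hws : w ≠ s) (hwsq : w ≠ insert q s) (hK : qEdges q F = {s})
    (hP : (projFam q F).card ≤
      omegaCount (U.erase q) (projFam q F) (projColour q o c0) (projColour q o c1)) :
    F.card ≤ omegaCount U F c0 c1 := by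
  refine card_le_omegaCount_of_step' ho hP ?_
  rw [hK, card_singleton]
  exact one_le_credit_of_anti_same hq hs hqs hsq h0 h1 hanti hw hws hwsq

end AntiSame

end PercRepro.MSTight
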